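import Summits.CriticalPhenomena.PercolationContinuityZ3.Theorems.PercNearOneGluingNoHeavyConstsMDLXJointAvoidSplit
import Summits.CriticalPhenomena.PercolationContinuityZ3.Theorems.PercNearOneGluingNoHeavyConstsMDLXJointAvoidSplitGain
import HarnessLib

/-!
# MDL(X)′ from MDL(X)″ and positive association in the linked world (PAPER-2 track (ii), seat `prim-consts-2`, gen 20)

builds on p205010 (kernel theorem, internal audit signed; external expert review pending).  Support file (`--supports
stmt-CriticalPhenomena-4575`); one theorem, no sorries, standard axioms.  Memo `run/shared/lean/prim/consts/FROM-prim-consts-2-g20-AVOID-SPLIT.md`.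

With the marker-avoidance split `μ(E₁)μ(D_Q)·M = μ(D)μ(D_Q)·M₁ + μ(T)μ(D)μ(E₁)·cov_{D_Q}(F;Z) + G·H` (`Consts.mdlx_avoidSplit_identity`) and the two
cross factors now theorems (`G ≥ 0`: `Consts.mdlx_gain_nonneg`; `H ≥ 0`: `Consts.avoidSplit_transfer_nonneg`), the `Consts.MDLXJoint` inequality at
`(w,s,y,z,X,F)` follows from the two BLOCK inequalities alone:
* `Consts.mdlxJoint_of_repelled_of_covQ` — if `M₁ ≥ 0` (MDL(X)″: the MDL(X)′ margin with the conditioning `{s↮X}` replaced by `{{s,y}↮X}`) and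
  `cov_{D_Q}(F;Z) ≥ 0` (`F(C_s)` and `1{s↔z}` nonnegatively correlated given `s ↮ X`, `y ↔ X`), then MDL(X)′ holds at that instance.
Both block inequalities FAIL in rare corners (memo §0(2),(3): exact witnesses), so this is a structural statement, not a route; it says exactly which
two "explaining-away" covariances a proof of `Consts.MDLXJoint` must trade against each other.
[cite: VandenbergHaggstromKahn2005, Thm. 2.1 (p. 9), §2.1 (pp. 9–13)]
-/

noncomputable section

namespace Summit.CriticalPhenomena.PercolationContinuityZ3.Theorems

open MeasureTheory Set Literature.Probability.LatticeModels Literature.Probability.Percolation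
open scoped Classical

namespace Consts

variable {V : Type*} [Fintype V]

/-- **MDL(X)′ ⟸ MDL(X)″ ∧ (PA of `F` and `{s↔z}` in the linked world `{s↮X, y↔X}`)**, instance by instance, for monotone `F`.
[cite: VandenbergHaggstromKahn2005, Thm. 2.1 (p. 9), §2.1 (pp. 9–13)] -/
theorem mdlxJoint_of_repelled_of_covQ (w : Sym2 V → unitInterval) (s y z : V) (X : Set V) (F : Set (Sym2 V) → ℝ) (hF : Monotone F)
    (h1 : 0 ≤ (prodBernoulli w).real ({ω : BondConfig V | ∀ x ∈ insert s X, ¬ (openGraph ω).Reachable y x} ∩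
            {ω | ∀ x ∈ X, ¬ (openGraph ω).Reachable s x}) *
          ((prodBernoulli w).real ({ω : BondConfig V | ∀ x ∈ X, ¬ (openGraph ω).Reachable s x} ∩ {ω | ∀ x ∈ X, ¬ (openGraph ω).Reachable y x}) *
              (∫ ω in {ω : BondConfig V | ∀ x ∈ X, ¬ (openGraph ω).Reachable s x} ∩ {ω | ∀ x ∈ X, ¬ (openGraph ω).Reachable y x} ∩ openConn s z,
                F (openEdgeCluster ω s) ∂(prodBernoulli w)) -
            (∫ ω in {ω : BondConfig V | ∀ x ∈ X, ¬ (openGraph ω).Reachable s x} ∩ {ω | ∀ x ∈ X, ¬ (openGraph ω).Reachable y x},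
                F (openEdgeCluster ω s) ∂(prodBernoulli w)) *
              (prodBernoulli w).real ({ω : BondConfig V | ∀ x ∈ X, ¬ (openGraph ω).Reachable s x} ∩ {ω | ∀ x ∈ X, ¬ (openGraph ω).Reachable y x} ∩
                openConn s z)) -
        (prodBernoulli w).real ({ω : BondConfig V | ∀ x ∈ insert s X, ¬ (openGraph ω).Reachable y x} ∩
            {ω | ∀ x ∈ X, ¬ (openGraph ω).Reachable s x} ∩ openConn y z) *
          ((prodBernoulli w).real ({ω : BondConfig V | ∀ x ∈ X, ¬ (openGraph ω).Reachable s x} ∩ {ω | ∀ x ∈ X, ¬ (openGraph ω).Reachable y x}) *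
              (∫ ω in {ω : BondConfig V | ∀ x ∈ X, ¬ (openGraph ω).Reachable s x} ∩ {ω | ∀ x ∈ X, ¬ (openGraph ω).Reachable y x} ∩ openConn s y,
                F (openEdgeCluster ω s) ∂(prodBernoulli w)) -
            (∫ ω in {ω : BondConfig V | ∀ x ∈ X, ¬ (openGraph ω).Reachable s x} ∩ {ω | ∀ x ∈ X, ¬ (openGraph ω).Reachable y x},
                F (openEdgeCluster ω s) ∂(prodBernoulli w)) *
              (prodBernoulli w).real ({ω : BondConfig V | ∀ x ∈ X, ¬ (openGraph ω).Reachable s x} ∩ {ω | ∀ x ∈ X, ¬ (openGraph ω).Reachable y x} ∩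
                openConn s y)))
    (hQ : 0 ≤ (prodBernoulli w).real ({ω : BondConfig V | ∀ x ∈ X, ¬ (openGraph ω).Reachable s x} ∩ {ω | ∀ x ∈ X, ¬ (openGraph ω).Reachable y x}ᶜ) *
            (∫ ω in {ω : BondConfig V | ∀ x ∈ X, ¬ (openGraph ω).Reachable s x} ∩ {ω | ∀ x ∈ X, ¬ (openGraph ω).Reachable y x}ᶜ ∩ openConn s z,
              F (openEdgeCluster ω s) ∂(prodBernoulli w)) -
          (∫ ω in {ω : BondConfig V | ∀ x ∈ X, ¬ (openGraph ω).Reachable s x} ∩ {ω | ∀ x ∈ X, ¬ (openGraph ω).Reachable y x}ᶜ,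
              F (openEdgeCluster ω s) ∂(prodBernoulli w)) *
            (prodBernoulli w).real ({ω : BondConfig V | ∀ x ∈ X, ¬ (openGraph ω).Reachable s x} ∩ {ω | ∀ x ∈ X, ¬ (openGraph ω).Reachable y x}ᶜ ∩
              openConn s z)) :
    (prodBernoulli w).real ({ω : BondConfig V | ∀ x ∈ insert s X, ¬ (openGraph ω).Reachable y x} ∩
          {ω | ∀ x ∈ X, ¬ (openGraph ω).Reachable s x} ∩ openConn y z) *
        ((prodBernoulli w).real {ω : BondConfig V | ∀ x ∈ X, ¬ (openGraph ω).Reachable s x} *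
            (∫ ω in {ω : BondConfig V | ∀ x ∈ X, ¬ (openGraph ω).Reachable s x} ∩ openConn s y,
              F (openEdgeCluster ω s) ∂(prodBernoulli w)) -
          (∫ ω in {ω : BondConfig V | ∀ x ∈ X, ¬ (openGraph ω).Reachable s x},
              F (openEdgeCluster ω s) ∂(prodBernoulli w)) *
            (prodBernoulli w).real ({ω : BondConfig V | ∀ x ∈ X, ¬ (openGraph ω).Reachable s x} ∩ openConn s y)) ≤
      (prodBernoulli w).real ({ω : BondConfig V | ∀ x ∈ insert s X, ¬ (openGraph ω).Reachable y x} ∩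
          {ω | ∀ x ∈ X, ¬ (openGraph ω).Reachable s x}) *
        ((prodBernoulli w).real {ω : BondConfig V | ∀ x ∈ X, ¬ (openGraph ω).Reachable s x} *
            (∫ ω in {ω : BondConfig V | ∀ x ∈ X, ¬ (openGraph ω).Reachable s x} ∩ openConn s z,
              F (openEdgeCluster ω s) ∂(prodBernoulli w)) -
          (∫ ω in {ω : BondConfig V | ∀ x ∈ X, ¬ (openGraph ω).Reachable s x},
              F (openEdgeCluster ω s) ∂(prodBernoulli w)) *
            (prodBernoulli w).real ({ω : BondConfig V | ∀ x ∈ X, ¬ (openGraph ω).Reachable s x} ∩ openConn s z)) := by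
  refine mdlxJoint_of_avoidSplit w s y z X F h1 ?_
  have hG := mdlx_gain_nonneg w s y z X
  have hH := avoidSplit_transfer_nonneg w s y X F hF
  have h0 : ∀ S : Set (BondConfig V), 0 ≤ (prodBernoulli w).real S := fun _ => measureReal_nonneg
  -- `G ≥ 0` in the letters of the identity
  have hG' : 0 ≤ (prodBernoulli w).real ({ω : BondConfig V | ∀ x ∈ insert s X, ¬ (openGraph ω).Reachable y x} ∩
              {ω | ∀ x ∈ X, ¬ (openGraph ω).Reachable s x}) *
            (prodBernoulli w).real ({ω : BondConfig V | ∀ x ∈ X, ¬ (openGraph ω).Reachable s x} ∩ {ω | ∀ x ∈ X, ¬ (openGraph ω).Reachable y x} ∩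
              openConn s z) *
            (prodBernoulli w).real ({ω : BondConfig V | ∀ x ∈ X, ¬ (openGraph ω).Reachable s x} ∩ {ω | ∀ x ∈ X, ¬ (openGraph ω).Reachable y x}ᶜ) -
          (prodBernoulli w).real ({ω : BondConfig V | ∀ x ∈ insert s X, ¬ (openGraph ω).Reachable y x} ∩
              {ω | ∀ x ∈ X, ¬ (openGraph ω).Reachable s x}) *
            (prodBernoulli w).real ({ω : BondConfig V | ∀ x ∈ X, ¬ (openGraph ω).Reachable s x} ∩ {ω | ∀ x ∈ X, ¬ (openGraph ω).Reachable y x}ᶜ ∩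
              openConn s z) *
            (prodBernoulli w).real ({ω : BondConfig V | ∀ x ∈ X, ¬ (openGraph ω).Reachable s x} ∩ {ω | ∀ x ∈ X, ¬ (openGraph ω).Reachable y x}) -
          (prodBernoulli w).real ({ω : BondConfig V | ∀ x ∈ insert s X, ¬ (openGraph ω).Reachable y x} ∩
              {ω | ∀ x ∈ X, ¬ (openGraph ω).Reachable s x} ∩ openConn y z) *
            (prodBernoulli w).real ({ω : BondConfig V | ∀ x ∈ X, ¬ (openGraph ω).Reachable s x} ∩ openConn s y) *
            (prodBernoulli w).real ({ω : BondConfig V | ∀ x ∈ X, ¬ (openGraph ω).Reachable s x} ∩ {ω | ∀ x ∈ X, ¬ (openGraph ω).Reachable y x}ᶜ) := by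
    -- from `hG`: tw·(d·dy − e·dy) ≤ t·(d·eZ − e·dZ) with d = e + q, dZ = eZ + qZ
    set μ := prodBernoulli w with hμ
    have hmeas : ∀ S : Set (BondConfig V), MeasurableSet S := fun _ => MeasurableSet.of_discrete
    set D : Set (BondConfig V) := {ω | ∀ x ∈ X, ¬ (openGraph ω).Reachable s x} with hD
    set Av : Set (BondConfig V) := {ω | ∀ x ∈ X, ¬ (openGraph ω).Reachable y x} with hAv
    have hd : μ.real D = μ.real (D ∩ Av) + μ.real (D ∩ Avᶜ) := by
      have h := measureReal_inter_add_sdiff (μ := μ) (s := D) (hmeas Av); rw [Set.sdiff_eq] at h; exact h.symm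
    have hz : μ.real (D ∩ openConn s z) = μ.real (D ∩ Av ∩ openConn s z) + μ.real (D ∩ Avᶜ ∩ openConn s z) := by
      have h := measureReal_inter_add_sdiff (μ := μ) (s := D ∩ openConn s z) (hmeas Av)
      rw [Set.sdiff_eq, inter_right_comm D (openConn s z) Av, inter_right_comm D (openConn s z) Avᶜ] at h; exact h.symm
    change μ.real _ * (μ.real D * μ.real (D ∩ openConn s y) - μ.real (D ∩ Av) * μ.real (D ∩ openConn s y)) ≤
      μ.real _ * (μ.real D * μ.real (D ∩ Av ∩ openConn s z) - μ.real (D ∩ Av) * μ.real (D ∩ openConn s z)) at hG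
    rw [hd, hz] at hG
    change 0 ≤ μ.real _ * μ.real (D ∩ Av ∩ openConn s z) * μ.real (D ∩ Avᶜ) -
        μ.real _ * μ.real (D ∩ Avᶜ ∩ openConn s z) * μ.real (D ∩ Av) - μ.real _ * μ.real (D ∩ openConn s y) * μ.real (D ∩ Avᶜ)
    nlinarith [hG]
  exact add_nonneg (mul_nonneg (mul_nonneg (mul_nonneg (h0 _) (h0 _)) (h0 _)) hQ) (mul_nonneg hG' (by linarith [hH]))

end Consts

end Summit.CriticalPhenomena.PercolationContinuityZ3.Theorems

end
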